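import Literature.Geometry.Riemannian.CurvatureFamilyBounds
import HarnessLib

/-!
# The gradient of the scalar curvature of a smooth family is bounded on compact space-time sets
(topic `Geometry/Riemannian`)

Companion of `CurvatureFamilyBounds.lean` (uniform curvature bounds `|Rm_t| ≤ K` on `M × S'`)
for first derivatives of scalar quantities. For a family `g` of `C^∞` Riemannian metrics on a
compact manifold `M`, `C^∞` on `M × S` (`IsContMDiffFamilyOn`), and a function `F` that is `C^∞`
on `M × S`, the gradient squares `|∇ F(·, t)|²_{g_t}(x) = g_t⁻¹(dF_t, dF_t)(x)` (`gradSq`) are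
bounded by one constant on `M × S'` for every compact `S' ⊆ S`. Applied to the scalar curvature
`R(x, t)` (jointly `C^∞` by `IsContMDiffFamilyOn.contMDiffOn_scalarCurvatureWith`,
`CurvatureFamilyRegularity.lean`) along a Ricci flow this is the bound `|∇R| ≤ Λ'` on compact
time sets that accompanies the curvature bound `|Rm| ≤ Λ` in the a-priori (flow-dependent)
Gaussian heat-kernel bounds of Bamler 2020a, proof of Thm. 7.2 (the constant of display (7.17)),
through the Bernstein estimate for the conjugate heat equation
(`ConjugateHeatGradientEstimate.lean`). Mathematically this is "continuity and compactness" under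
the standing convention that all curvature quantities of a smooth family are smooth on space-time
(Topping 2006, §1.2.3); the work is the joint continuity of the frame derivatives
`(x, t) ↦ dF_t(X_v)(x)` (`contMDiffOn_mvfderiv_slice`, valid for an ARBITRARY time set `S`) and
an elementary bound of `g⁻¹(α, α)` by the frame components of `α` under uniform
positive-definiteness of the frame Gram matrices (`exists_pos_mul_norm_sq_le_val_symmL`).

## Contents (all proved)

* `gradSq_le_of_frame_bounds` — pointwise algebra: if `λ‖w‖² ≤ g_x(X_w, X_w)` for all `w`
  (`X_w = e.symmL x w` the frame of the trivialization `e` at `x₀`), `Σᵢ |wᵢ| ≤ c₀ ‖w‖` for the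
  coordinates in a basis `b`, and `|dψ_x(X_{bᵢ})| ≤ B`, then `gradSq_g ψ x ≤ (c₀ B)² / λ`.
* `IsContMDiffFamilyOn.exists_gradSq_le_nhds`, `IsContMDiffFamilyOn.exists_gradSq_le_of_isCompact`
  — the local (near `x₀`, uniformly in `t ∈ S'`) and global (`M` compact Hausdorff) bounds
  `gradSq_{g_t}(F(·, t))(x) ≤ C`.
* `IsContMDiffFamilyOn.exists_gradSq_scalarCurvatureWith_le` — the case `F = R`.
* `exists_gradSq_scalarCurvature_le` — for a Ricci flow of Riemannian metrics on a compact
  manifold and a compact set of times `S' ⊆ S`: `∃ Λ' ≥ 0, |∇R_{g_r}|²_{g_r} ≤ Λ'²` on `M × S'`.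

## References

* [Topping2006] P. Topping, *Lectures on the Ricci flow*, LMS Lecture Note Series 325, Cambridge
  Univ. Press 2006, §1.2.3 (smoothness convention on space-time), §5.3 (p. 46, compactness in
  time).
* [Bamler2020Entropy] R. H. Bamler, *Entropy and heat kernel bounds on a Ricci flow background*,
  arXiv:2008.07093 (2020), §7, proof of Thm. 7.2 (flow-dependent constants from bounded geometry
  on compact time-intervals).
* [ONeill1983] B. O'Neill, *Semi-Riemannian geometry*, Academic Press 1983, Ch. 3, p. 60
  (`♯`, the inverse metric on covectors), p. 85 (gradient).
-/

noncomputable section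

open Bundle Set Function Filter
open scoped Manifold ContDiff Topology BigOperators

namespace Literature.Geometry.Riemannian

open Lorentzian Lorentzian.PseudoRiemannianMetric

variable {E : Type*} [NormedAddCommGroup E] [NormedSpace ℝ E] {H : Type*} [TopologicalSpace H]
  {I : ModelWithCorners ℝ E H} {M : Type*} [TopologicalSpace M] [ChartedSpace H M]
  [IsManifold I ∞ M] (x₀ : M) [FiniteDimensional ℝ E] [CompleteSpace E]
  {g : ℝ → PseudoRiemannianMetric I ∞ E (TangentSpace I : M → Type _)} {S : Set ℝ}
  {cov : ℝ → CovariantDerivative I E (TangentSpace I : M → Type _)}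

/-! ### Pointwise: the gradient square against frame derivatives -/

omit [CompleteSpace E] in
/-- **The gradient square is controlled by the frame derivatives under uniform
positive-definiteness.** Let `e` be the trivialization of `TM` at `x₀`, `x ∈ e.baseSet`,
`X_w = e.symmL x w` its frame, `b` a basis of `E` with `Σᵢ |bⁱ(v)| ≤ c₀ ‖v‖`, and `g'` a metric
with `λ ‖w‖² ≤ g'_x(X_w, X_w)` for all `w` (`λ > 0`). If `|dψ_x(X_{bᵢ})| ≤ B` for all `i`, then
`g'⁻¹(dψ_x, dψ_x) ≤ (c₀ B)² / λ`. Indeed with `V = ♯dψ_x = X_w`: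
`λ‖w‖² ≤ g'(V, V) = dψ_x(V) = Σᵢ wᵢ dψ_x(X_{bᵢ}) ≤ c₀ ‖w‖ B`. [folklore] -/
theorem gradSq_le_of_frame_bounds {ι : Type*} [Fintype ι] (b : Module.Basis ι ℝ E) {n : ℕ∞ω}
    (g' : PseudoRiemannianMetric I n E (TangentSpace I : M → Type _)) {x : M}
    (hx : x ∈ (trivializationAt E (TangentSpace I : M → Type _) x₀).baseSet)
    {lam c₀ B : ℝ} (hlam : 0 < lam) (hc₀ : 0 ≤ c₀) (hB : 0 ≤ B)
    (hpos : ∀ w : E, lam * ‖w‖ ^ 2 ≤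
      g'.val x ((trivializationAt E (TangentSpace I : M → Type _) x₀).symmL ℝ x w)
        ((trivializationAt E (TangentSpace I : M → Type _) x₀).symmL ℝ x w))
    (hc : ∀ v : E, ∑ i, |b.repr v i| ≤ c₀ * ‖v‖) (ψ : M → ℝ)
    (hψ : ∀ i, |mvfderiv I ψ x
      ((trivializationAt E (TangentSpace I : M → Type _) x₀).symmL ℝ x (b i))| ≤ B) :
    g'.gradSq ψ x ≤ (c₀ * B) ^ 2 / lam := by
  set e := trivializationAt E (TangentSpace I : M → Type _) x₀ with he
  set α : TangentSpace I x →L[ℝ] ℝ := mvfderiv I ψ x with hα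
  set V : TangentSpace I x := g'.sharp x (α : TangentSpace I x →ₗ[ℝ] ℝ) with hV
  have hgrad : g'.gradSq ψ x = α V := rfl
  have hVV : g'.val x V V = α V := by
    rw [hV, val_sharp_apply]
    rfl
  set w : E := e.continuousLinearMapAt ℝ x V with hw
  have hVw : e.symmL ℝ x w = V := e.symmL_continuousLinearMapAt hx V
  -- `λ ‖w‖² ≤ dψ(V)`
  have h1 : lam * ‖w‖ ^ 2 ≤ α V := by
    have h := hpos w
    rw [hVw, hVV] at h
    exact h
  -- `dψ(V) = Σᵢ wᵢ dψ(X_{bᵢ}) ≤ c₀ ‖w‖ B`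
  have h2 : α V = ∑ i, b.repr w i * α (e.symmL ℝ x (b i)) := by
    conv_lhs => rw [eq_sum_repr_smul_symmL x₀ b hx V]
    simp only [map_sum, map_smul, smul_eq_mul]
    rfl
  have h3 : α V ≤ c₀ * ‖w‖ * B := by
    rw [h2]
    calc ∑ i, b.repr w i * α (e.symmL ℝ x (b i))
        ≤ ∑ i, |b.repr w i| * B := Finset.sum_le_sum fun i _ ↦ by
            calc b.repr w i * α (e.symmL ℝ x (b i))
                ≤ |b.repr w i * α (e.symmL ℝ x (b i))| := le_abs_self _
              _ = |b.repr w i| * |α (e.symmL ℝ x (b i))| := abs_mul _ _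
              _ ≤ |b.repr w i| * B := mul_le_mul_of_nonneg_left (hψ i) (abs_nonneg _)
      _ = (∑ i, |b.repr w i|) * B := (Finset.sum_mul _ _ _).symm
      _ ≤ c₀ * ‖w‖ * B := mul_le_mul_of_nonneg_right (hc w) hB
  have hRHS : 0 ≤ (c₀ * B) ^ 2 / lam := div_nonneg (sq_nonneg _) hlam.le
  rw [hgrad]
  rcases (norm_nonneg w).eq_or_lt with hw0 | hwpos
  · -- `w = 0`
    have h4 : α V ≤ 0 := by
      rw [← hw0] at h3
      simpa using h3
    exact h4.trans hRHS
  · have h4 : lam * ‖w‖ ≤ c₀ * B := by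
      have h5 : lam * ‖w‖ ^ 2 ≤ c₀ * ‖w‖ * B := h1.trans h3
      have h6 : lam * ‖w‖ * ‖w‖ ≤ c₀ * B * ‖w‖ := by
        calc lam * ‖w‖ * ‖w‖ = lam * ‖w‖ ^ 2 := by ring
          _ ≤ c₀ * ‖w‖ * B := h5
          _ = c₀ * B * ‖w‖ := by ring
      exact le_of_mul_le_mul_right h6 hwpos
    have h7 : ‖w‖ ≤ c₀ * B / lam := by
      rw [le_div_iff₀ hlam, mul_comm]
      exact h4
    calc α V ≤ c₀ * ‖w‖ * B := h3
      _ ≤ c₀ * (c₀ * B / lam) * B :=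
          mul_le_mul_of_nonneg_right (mul_le_mul_of_nonneg_left h7 hc₀) hB
      _ = (c₀ * B) ^ 2 / lam := by ring

/-! ### Uniform gradient bounds on compact space-time sets -/

omit [CompleteSpace E] in
/-- **Local uniform gradient bound for a smooth family.** For `g` `C^∞` on `M × S`, Riemannian
at the times of a compact `S' ⊆ S`, and `F` `C^∞` on `M × S`: near every `x₀` (on a
neighbourhood `U`, `M` locally compact Hausdorff), `gradSq_{g_t}(F(·, t))(x) ≤ C` for `x ∈ U`,
`t ∈ S'`. Proof: on a compact neighbourhood `K ⊆ e.baseSet` of `x₀` the frame Gram matrices are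
uniformly positive definite (`exists_pos_mul_norm_sq_le_val_symmL`), the frame derivatives
`(x, t) ↦ dF_t(X_{bᵢ})(x)` are continuous on `e.baseSet × S` (`contMDiffOn_mvfderiv_slice`),
hence bounded on `K × S'`; conclude by `gradSq_le_of_frame_bounds`. [folklore] -/
theorem IsContMDiffFamilyOn.exists_gradSq_le_nhds [T2Space M] [LocallyCompactSpace M]
    (hg : IsContMDiffFamilyOn ∞ g S) {S' : Set ℝ} (hS' : IsCompact S') (hS'S : S' ⊆ S)
    (hR : ∀ t ∈ S', (g t).IsRiemannian) {F : M × ℝ → ℝ}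
    (hF : ContMDiffOn (I.prod 𝓘(ℝ, ℝ)) 𝓘(ℝ, ℝ) ∞ F (univ ×ˢ S)) :
    ∃ U ∈ 𝓝 x₀, ∃ C : ℝ, ∀ x ∈ U, ∀ t ∈ S', (g t).gradSq (fun y ↦ F (y, t)) x ≤ C := by
  classical
  set e := trivializationAt E (TangentSpace I : M → Type _) x₀ with he
  have hmem : x₀ ∈ e.baseSet := mem_baseSet_trivializationAt E (TangentSpace I : M → Type _) x₀
  obtain ⟨K, hKnhds, hKe, hK⟩ :=
    LocallyCompactSpace.local_compact_nhds x₀ e.baseSet (e.open_baseSet.mem_nhds hmem)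
  set bE := Module.finBasis ℝ E with hbE
  obtain ⟨lam, hlam, hlamle⟩ := hg.exists_pos_mul_norm_sq_le_val_symmL x₀ hS' hS'S hR hK hKe
  -- the frame derivatives are jointly continuous, hence bounded on `K × S'`
  set D : Fin (Module.finrank ℝ E) → M × ℝ → ℝ := fun i p ↦
    mvfderiv I (fun y ↦ F (y, p.2)) p.1 (e.symmL ℝ p.1 (bE i)) with hD_def
  have hDcont : ∀ i, ContinuousOn (D i) (e.baseSet ×ˢ S) := fun i ↦
    (contMDiffOn_mvfderiv_slice x₀ e.open_baseSet subset_rfl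
      (hF.mono (prod_mono (subset_univ _) subset_rfl)) (bE i)).continuousOn
  set Dsum : M × ℝ → ℝ := fun p ↦ ∑ i, |D i p| with hDsum_def
  have hDsum : ContinuousOn Dsum (e.baseSet ×ˢ S) :=
    continuousOn_finsetSum _ fun i _ ↦ (hDcont i).abs
  obtain ⟨B, hB⟩ := (hK.prod hS').exists_bound_of_continuousOn
    (hDsum.mono (prod_mono hKe hS'S))
  have hBi : ∀ x ∈ K, ∀ t ∈ S', ∀ i,
      |mvfderiv I (fun y ↦ F (y, t)) x (e.symmL ℝ x (bE i))| ≤ |B| := by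
    intro x hx t ht i
    have h := hB (x, t) ⟨hx, ht⟩
    rw [Real.norm_eq_abs] at h
    calc |mvfderiv I (fun y ↦ F (y, t)) x (e.symmL ℝ x (bE i))| = |D i (x, t)| := rfl
      _ ≤ Dsum (x, t) :=
          Finset.single_le_sum (f := fun j ↦ |D j (x, t)|) (fun j _ ↦ abs_nonneg _)
            (Finset.mem_univ i)
      _ ≤ |Dsum (x, t)| := le_abs_self _
      _ ≤ |B| := h.trans (le_abs_self B)
  -- the coordinate functionals
  set L : Fin (Module.finrank ℝ E) → E →L[ℝ] ℝ :=
    fun i ↦ LinearMap.toContinuousLinearMap (bE.coord i) with hL_def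
  set c₀ : ℝ := ∑ i, ‖L i‖ with hc₀_def
  have hc₀nn : 0 ≤ c₀ := Finset.sum_nonneg fun i _ ↦ norm_nonneg _
  have hc : ∀ v : E, ∑ i, |bE.repr v i| ≤ c₀ * ‖v‖ := by
    intro v
    rw [hc₀_def, Finset.sum_mul]
    refine Finset.sum_le_sum fun i _ ↦ ?_
    have := (L i).le_opNorm v
    simpa [hL_def, Module.Basis.coord_apply] using this
  refine ⟨K, hKnhds, (c₀ * |B|) ^ 2 / lam, fun x hx t ht ↦ ?_⟩
  exact gradSq_le_of_frame_bounds x₀ bE (g t) (hKe hx) hlam hc₀nn (abs_nonneg B)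
    (hlamle x hx t ht) hc _ (hBi x hx t ht)

omit [CompleteSpace E] in
/-- **The gradient of a smooth space-time function along a smooth family of Riemannian metrics
on a compact manifold is bounded on compact time sets**: for `g` `C^∞` on `M × S`, `M` compact
Hausdorff, `S' ⊆ S` compact with `g_t` Riemannian for `t ∈ S'`, and `F` `C^∞` on `M × S`, there
is `C ≥ 0` with `gradSq_{g_t}(F(·, t))(x) ≤ C` for all `x ∈ M`, `t ∈ S'`. Finitely many of the
neighbourhoods of `exists_gradSq_le_nhds` cover `M` (as in
`IsContMDiffFamilyOn.exists_curvatureBoundedBy_of_isCompact`).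
[cite: Topping2006, §1.2.3 and §5.3 (p. 46)] -/
theorem IsContMDiffFamilyOn.exists_gradSq_le_of_isCompact [T2Space M] [CompactSpace M]
    (hg : IsContMDiffFamilyOn ∞ g S) {S' : Set ℝ} (hS' : IsCompact S') (hS'S : S' ⊆ S)
    (hR : ∀ t ∈ S', (g t).IsRiemannian) {F : M × ℝ → ℝ}
    (hF : ContMDiffOn (I.prod 𝓘(ℝ, ℝ)) 𝓘(ℝ, ℝ) ∞ F (univ ×ˢ S)) :
    ∃ C : ℝ, 0 ≤ C ∧ ∀ t ∈ S', ∀ x : M, (g t).gradSq (fun y ↦ F (y, t)) x ≤ C := by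
  classical
  choose U hU C hC using fun x₀ : M ↦ hg.exists_gradSq_le_nhds x₀ hS' hS'S hR hF
  obtain ⟨s, -, hcover⟩ := isCompact_univ.elim_nhds_subcover U fun x _ ↦ hU x
  refine ⟨∑ x ∈ s, |C x|, Finset.sum_nonneg fun x _ ↦ abs_nonneg _, fun t ht x ↦ ?_⟩
  obtain ⟨x₁, hx₁s, hxU⟩ : ∃ x₁ ∈ s, x ∈ U x₁ := by
    have := hcover (mem_univ x)
    simpa only [mem_iUnion, exists_prop] using this
  calc (g t).gradSq (fun y ↦ F (y, t)) x ≤ C x₁ := hC x₁ x hxU t ht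
    _ ≤ |C x₁| := le_abs_self _
    _ ≤ ∑ x ∈ s, |C x| :=
        Finset.single_le_sum (f := fun x ↦ |C x|) (fun x _ ↦ abs_nonneg _) hx₁s

/-- **The gradient of the scalar curvature of a smooth family is bounded on compact time sets**:
for `g` `C^∞` on `M × S` with Levi-Civita witnesses `cov t` (`t ∈ S`), `M` compact Hausdorff, and
a compact `S' ⊆ S` at whose times the metrics are Riemannian, there is `C ≥ 0` with
`|∇R_{g_t}|²_{g_t}(x) ≤ C` on `M × S'` — `exists_gradSq_le_of_isCompact` for `F = R`, jointly
`C^∞` on `M × S` by `IsContMDiffFamilyOn.contMDiffOn_scalarCurvatureWith`.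
[cite: Topping2006, §1.2.3 and §5.3 (p. 46)] -/
theorem IsContMDiffFamilyOn.exists_gradSq_scalarCurvatureWith_le [T2Space M] [CompactSpace M]
    (hg : IsContMDiffFamilyOn ∞ g S) (hLC : ∀ t ∈ S, (g t).IsLeviCivita (cov t)) {S' : Set ℝ}
    (hS' : IsCompact S') (hS'S : S' ⊆ S) (hR : ∀ t ∈ S', (g t).IsRiemannian) :
    ∃ C : ℝ, 0 ≤ C ∧ ∀ t ∈ S', ∀ x : M,
      (g t).gradSq (fun y ↦ (g t).scalarCurvatureWith (cov t) y) x ≤ C :=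
  hg.exists_gradSq_le_of_isCompact hS' hS'S hR
    (F := fun p ↦ (g p.2).scalarCurvatureWith (cov p.2) p.1)
    (hg.contMDiffOn_scalarCurvatureWith hLC)

/-! ### Along a Ricci flow -/

/-- **`|∇R|` is bounded on compact time sets along a Ricci flow on a compact manifold** (the
bound `|∇R| ≤ Λ'` accompanying `|Rm| ≤ Λ` on compact time-intervals in the flow-dependent
a-priori Gaussian heat-kernel bound of Bamler 2020a, proof of Thm. 7.2, under the space-time
smoothness convention of Topping 2006, §1.2.3): for a Ricci flow `(h, cov)` of Riemannian
metrics on the time set `S` (`IsRicciFlow`: `h` is `C^∞` on `M × S`, `cov r` Levi-Civita) on a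
compact Hausdorff manifold and a compact `S' ⊆ S`, there is `Λ' ≥ 0` with
`gradSq_{h r}(R_{h r})(y) ≤ Λ'²` for all `r ∈ S'`, `y ∈ M`.
[cite: Bamler2020Entropy, §7, proof of Thm. 7.2] [cite: Topping2006, §1.2.3] -/
theorem exists_gradSq_scalarCurvature_le {m : ℕ} {H : Type*} [TopologicalSpace H]
    {I : ModelWithCorners ℝ (EuclideanSpace ℝ (Fin m)) H} [I.Boundaryless]
    {M : Type*} [TopologicalSpace M] [ChartedSpace H M] [IsManifold I ∞ M] [T2Space M]
    [CompactSpace M]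
    {h : ℝ → PseudoRiemannianMetric I ∞ (EuclideanSpace ℝ (Fin m)) (TangentSpace I : M → Type _)}
    {cov : ℝ → CovariantDerivative I (EuclideanSpace ℝ (Fin m)) (TangentSpace I : M → Type _)}
    {S : Set ℝ} (hflow : IsRicciFlow h cov S) (hR : ∀ r ∈ S, (h r).IsRiemannian) {S' : Set ℝ}
    (hS' : IsCompact S') (hS'S : S' ⊆ S) :
    ∃ Λ' : ℝ, 0 ≤ Λ' ∧ ∀ r ∈ S', ∀ y : M,
      (h r).gradSq (fun z ↦ (h r).scalarCurvatureWith (cov r) z) y ≤ Λ' ^ 2 := by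
  obtain ⟨C, hC0, hC⟩ := hflow.smooth.exists_gradSq_scalarCurvatureWith_le hflow.isLeviCivita
    hS' hS'S fun r hr ↦ hR r (hS'S hr)
  refine ⟨Real.sqrt C, Real.sqrt_nonneg _, fun r hr y ↦ ?_⟩
  rw [Real.sq_sqrt hC0]
  exact hC r hr y

end Literature.Geometry.Riemannian
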